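import Literature.MathematicalPhysics.QuantumFieldTheory.Balaban1983to89.B6Prop26KLevelAssemblyV1
import Literature.MathematicalPhysics.QuantumFieldTheory.Balaban1983to89.B6Prop26LeftEntryKLevelV1L0
import Literature.MathematicalPhysics.QuantumFieldTheory.Balaban1983to89.B6CubeInDecayV1L0
import Literature.MathematicalPhysics.QuantumFieldTheory.Balaban1983to89.B6CubeInDecayV1L3
import Literature.MathematicalPhysics.QuantumFieldTheory.Balaban1983to89.B6CubeCoeffSizesV1L0
import Literature.MathematicalPhysics.QuantumFieldTheory.Balaban1983to89.B6CubeCoeffSizesV1L3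
import Literature.MathematicalPhysics.QuantumFieldTheory.Balaban1983to89.B6GradLegKLevelV1
import Literature.MathematicalPhysics.QuantumFieldTheory.Balaban1983to89.B6GradLegKLevelV1L0
/-!
# `Balaban1983to89.B6GradLegKLevelV1L3` — RE-CENTRED-WINDOW TWIN (sub-row G-F3′-L0∕L3 of programme G-F3′-L0; UV3-NODE §26.3 (P2-L3); every odd `L ≥ 3`;
ruling of record `lit-balaban-r03/G-F3L0-PLAN.md` v1.5 §13 (B′), joints J9′–J11′, J14) of `B6GradLegKLevelV1L0`: the SAME declarations, names and
statements over p21's re-centred root `B6CubeWindowV1L3` (window corner `x0C = S_j·(qc − ℓ) = ctr − (2L−1)S_j/2` — the cube's central block is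
the middle block of its `2L`-block member torus, print p.238 «□ in the middle of □̃³ = T_□»; reach sub-window corner `x1C = x0C + (L−2)S_j`;
`PlacedC`; `eC`, `ρ`, `R ≥ 2L²`, `C = 9`, `M_c = 8S/3` UNCHANGED; the binder `(4 ≤ ℓ)` DROPPED).  J14: ONLY the window-dependent declarations are
re-declared here; every window-free declaration of the L0 twin and every `D`-free object of the lineage is consumed BY NAME.  No existing module is
touched; no fact is minted; standard axioms.  Unit `lit-balaban-p33` (gen 90), 2026-08-27.  THE TWIN'S DOCUMENTATION FOLLOWS VERBATIM (its
«x₀ = ctr − L·S_j/2» / «L ≥ 5» sentences describe the twin; here the anchor is `(2L−1)S_j/2` and L ≥ 3).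

statement-level skeleton of published theorems with citation tags; proofs where landed; nothing here is a claim about the Yang–Mills mass gap

# `Balaban1983to89.B6GradLegKLevelV1L0` — LEVEL-0 TWIN (programme G-F3′-L0, director-ym LINE №27 / UV3-NODE §24.5; plan `lit-balaban-r03/G-F3L0-PLAN.md`) of `B6GradLegKLevelV1`:
the same declarations, SAME NAMES AND STATEMENTS, for nested families WITH print's region `Λ₀ = T ∖ Ω₁` ADMITTED (structures
`B6MultiLevelBoxOperatorL0.Domains` / `B6MultiLevelTorusOperatorL0.TDomains`: levels `0, …, k`, the level-`0` block a single site, `Q′₀ = id`,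
finite weight `a₀` — print p.225 (2.14) «Σ_{j=0}^k … (Q′₀λ)(x) = λ(x), x ∈ Λ₀», p.229 «taking a sequence (2.1) … smallest possible domains B^j(Λ_j),
and considering the operator Δ_a defined by (2.19), (2.20) for this sequence»).  Every `D`-free object is the lineage's, consumed BY NAME; no existing
module is touched; no fact is minted.  Unit `lit-balaban-p33` (p33 gen 89; S-E entry twins named to p33 by the B6 owner r03 gen 36, ruling 2026-08-27T18:45:57Z; port tooling by r03 gen 36); B6 fold owner r03; referee ref-4.  LEVEL-0 JOINT J8 (B6 owner r03 gen 36, ruling 2026-08-27T19:48:28Z): `abs_hB_shift_sub_le` takes `(hMhL : 2 * (ℓ + 1) ≤ Mh)` IN PLACE of the twin's `(hMh : 2 ≤ Mh)` (its only use: the J2 size `abs_hT_sub_le_near`), and the telescope of `hDG0_cube` gains `(_ : 2 * (ℓ + 1) ≤ Mh)` right after `(_ : 8 ≤ Mh)`; every other statement is the twin's verbatim.  THE TWIN'S DOCUMENTATION FOLLOWS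
VERBATIM (its «levels 1 … k» / «Ω₁ = X» sentences describe the twin; here `j` runs from `0` and `Ω₁` may be a proper subset).

# `Balaban1983to89.B6GradLegKLevelV1` — T. Bałaban, *Propagators and renormalization transformations for lattice gauge theories. II*,
# Commun. Math. Phys. **96** (1984) 223–250 [Balaban1984PropagatorsII], Prop. 2.6 p. 247, THE FIRST LEG `∇(h_□G_□h_□)` OF (2.141) FOR THE ENTRY
# `|(∇GJ)(x)| ≤ O(1)·Lʲη·e^{−δ₃d(y,y′)}|J|` OF (2.136), FOR THE GENUINE MEMBER `G_□` OF A CUBE ON THE `k`-LEVEL V1 TORUS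

statement-level skeleton of published theorems with citation tags; proofs where landed; nothing here is a claim about the Yang–Mills mass gap

PDF held: `paper:balaban1984-cmp96-propagators-rt-ii` (journal page = PDF page + 222), p. 247 [PDF 25] re-read this generation (text layer `p0025.txt`):
*"|(G_□J)(x)|, |(∇G_□J)(x)| ≤ O(1)[(Lʲη)², Lʲη]e^{−δ₂(Lʲη)^{−1}dist(Δ,Δ′)}|J| (2.133)"*; *"|(GJ)(x)|, |(∇GJ)(x)|, |(G∇*J)(x)|, |(ΔGJ)(x)| ≤
O(1)[(Lʲη)², Lʲη, Lʲη, 1]e^{−δ₃d(y,y′)}|J| (2.136)"*; *"G = G₀(I − R)⁻¹ = … = Σ_ω h_{□₀}G_{□₀}h_{□₀}K_{□₁}… (2.141)"*; p. 239 [PDF 17] (2.92) line 1: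
*"Σ_{b∈st(x)}(∂h_□)(b)(∂A_μ)(b) + (Δh_□)(x)A_μ(x)"* and p. 247's size remark on `∂h_□` (our reading, cf. [3] p. 577: `|∂^ηh_j| ≤ O(M⁻¹)` per `ξ`-step).

CITATION HEADER (lean-in-tree rule) — WHAT IS REPRODUCED.  Phase-2 file of the `lit-balaban` typed skeleton (HOME `run/shared/lean/pub/lit-balaban/`),
seat **p38 gen 30** (free target under protocol G.5-34(d), TAKING line HOME/STATUS.md 2026-08-23T13:2xZ; consumer r05's «slot 2» of
`…B8Prop3MultiLevelTorusP26`); SKELETON rows **B6.Prop2.6** × B6.Eq2.133 × B6.Eq2.141 × B6.Eq2.92 (cells only; decls of record untouched).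
THE MATHEMATICS (print's *"reasoning in the same way as in the proof of Proposition 2.2"* for the second column of the table): the first leg of the
walk (2.141) for `∇_νG` is `∇_ν(h_□G_□h_□) = (h_□∘τ_ν)·(∇_νG_□)·h_□ + (∇_νh_□)·G_□·h_□` (lattice product rule); the first term is (2.133)₂ for the member
(`O(1)·Lʲη`), the second is `|∇_νh_□| ≤ O(1)(MLʲη)⁻¹` times (2.133)₁ (`O(1)(Lʲη)²`), i.e. `O(M⁻¹)Lʲη` — together `O(1)·L^{j(y)}η·e^{−δd_T}` at the
output block `y`.  THIS FILE, on r03's cube members (`…B6CubeWindowV1L3.Gl`, the skeleton's `h_□ = hB`, p38's legs `E_e` of `…B6Eq292MemberTorusV1`):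
* §1 (any V1 torus `P`): `shB ν` (`(S_νf)(b) = f(b + e_ν)`, same direction), **`DV ν c′ := c′•(S_ν − 1)`** — the forward difference `∇^η_ν` of fine
  bond functions in direction `ν` with the fine factor `c′ = η⁻¹` (componentwise on vector fields; r05's abstract `Dop ν`); `DV_apply`; the product rule
  **`DV_mul_mulOp`** `DV·(h·) = ((S_νh)·)·DV + ((DV h)·)`; `TB_mul_shB`/`TB_mul_DV` (the torus translations commute with `S_ν`, `Site.shift_add`);
* §2 (a two-scale member `t` with its full bond window chart `cB t x₀`, r03's `…B6AgreeLapV1Chart`): **`transplant_Dl_apply_deep`** — on a bond whose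
  initial point is `1`-deep in the window, the transplant of the member's `∇_ν = Lʲ(S_ν − 1)` (`TSIdx.Dl`) IS `Lʲ·(f(b + e_ν) − f(b))` (`eS_shift`: the
  chart intertwines the shifts away from the window's faces); **`mulOp_mul_transplant_Dl`**: `χ·ε∇_νρ = (Lʲ/c′)•χ·DV ν c′` for every `χ` supported on
  `1`-deep bonds;
* §3 (the cube `□` of p21's torus family, r03's letters `tC/x0C/sc/wC/Gl`, p38's `EC`): **`mulOp_mul_EC_true`**: `χ·E_(ν,+) = (L^{j₀}/c′)•χ·DV ν c′` for
  `χ` whose chart translate is supported `1`-deep (`EC = τ_{−v}(ε∇_νρ)τ_v`, `TB_mul_DV`); supports and sizes of `h_□`: `blkV1_mem_ST_of_hB_shift_ne_zero`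
  (the block of `b` is in `□⁺` when `h_□(b + e_ν) ≠ 0`; p38's `blkOf_mem_QT_of_near_hT`, `M_h ≥ 8`), `abs_hB_shift_sub_le` (`|h_□(b + e_ν) − h_□(b)| ≤
  C1F/(8S/5)`, p38's `abs_hT_sub_le_near`), `shB_hB_deep` (the chart translate of `S_νh_□` is `1`-deep: r03's `hch_deep`);
  **`DV_sandwich_eq`**: `DV ν c′·(h_□G_□h_□) = (c′/L^{j₀})•((S_νh_□)·(E_(ν,+)G_□)·h_□) + (DV h_□)·G_□·h_□` (operator identity on the global torus);
* §4 **`hDG0_cube`** — THE FIRST LEG OF (2.141) FOR `∇_νG` PER CUBE: there are `ρ_D > 0`, `C_D ≥ 0` (on `d, L` and the weight band only) such that on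
  every admissible torus (`M_h = Lᵃ ≥ 8`, `R ≥ 2L²`, `P′ ≥ 5`, `L ≥ 5`, cube placed), for every `c′ ≠ 0`, weights `w`, direction `ν` and cube `□`:
  `HasMajorant (geomT D) (blkV1 hN D) (DV ν c′ * (h_□·G_□·h_□)) (1_{□⁺}(y)·C_D·(L^{j(y)}·|c′|⁻¹)·e^{−ρ_D d_T(y,y′)})` — from r03's `hGin_cube` ((2.133)₁,
  input-localised, prefactor `(L^{j(y)}/c′)²`) and `hEGin_cube` ((2.133)₂ legs `E_eG_□`) BY NAME through `hasMajorant_sandwich_in`, with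
  `|c′|/L^{j₀}·(L^{j(y)})²/c′² ≤ L²·L^{j(y)}/|c′|` and `|c′|·C1F/(8S/5)·(L^{j(y)})²/c′² ≤ L²·C1F·L^{j(y)}/|c′|` on `□⁺` (levels `j(y) ≤ j₀ + 2`,
  `S ≥ L^{j₀}`).
Defs with bodies: `shB`, `DV` (§1).  No `def … : Prop`, no new hypothesis; standard axioms.

HONEST SCOPE / DIVERGENCES.  (1) `DV ν c′ = c′•(S_ν − 1)` uses the SIGNED fine factor `c′` like the tree's `dE c′` (print: `η⁻¹ > 0`); all bounds are in
`|c′|`.  (2) The prefactor delivered is `L^{j(y)}/|c′|` at the OUTPUT block with a constant carrying `L²` (print: `O(1)Lʲη`, constants on `d, L`); the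
`M⁻¹` of the `∇h_□`-term is not kept (not needed for (2.136)₂).  (3) Hypotheses as r03's member inputs (`L ≥ 5` from the band lemma, `M_h = Lᵃ ≥ 8`,
`R ≥ 2L²`, `P′ ≥ 5`, placed cube).  (4) This is ONE leg; the walk/assembly is `…B6Prop26LeftEntryKLevelV1` (landed separately) + the pair assembly and
the final (2.136)₂ theorem (next files of this seat).  Integer torus, lattice units; nothing on d = 4 specifically or the continuum; NOT summit progress.
Unit `lit-balaban-p38` (gen 30), 2026-08-23.
-/

noncomputable section

open scoped BigOperators
open Finset

namespace Literature.MathematicalPhysics.QuantumFieldTheory.Balaban1983to89.B6GradLegKLevelV1L3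

open LatticeFieldCalculus
open B4Reflection242 (boxDom)
open B4TorusKernel.MultiPeriod (torusSupNorm)
open B6MultiLevelBoxOperator (N0 bigSide)
open B6MultiLevelTorusOperator (tshift unitVec one_le_of_mem)
open B6MultiLevelTorusOperatorL0 (TDomains)
open B6Cover236MultiLevelBlocksL0 (cubes)
open B6Geom246MultiLevelBoxL0 (bset blkOf)
open B6Geom246MultiLevelTorus (torusSupNorm_neg)
open B6Geom246MultiLevelTorusL0 (geomT)
open B8Ineq192MultiLevelTorusL0 (geomT_len)
open B6Eq238MultiLevelTorus (svec)
open B6RandomWalk (HasMajorant hasMajorant_mono hasMajorant_add BlockSupp)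
open B6Prop26Gluing (mulOp mulOp_apply ind ind_nonneg ind_le_one ind_of_mem ind_of_not_mem)
open B6Ineq2133TwoScaleV1 (onFun onFun_apply)
open B6Prop26ReachTransplant (transplant restrictOp extendOp transplant_apply restrictOp_apply_of_injOn extendOp_apply)
open B6GlobalChartV1 (PV toBox)
open B6GlobalChartV1L0 (blkV1 domT)
open B6AgreeLapV1Chart (cB eB eS DeepS mem_cB_W eS_shift deepS_mono shift_mem_deepS unshift_mem_deepS)
open B6Prop25TwoScaleCensus (TSIdx)
open B6SectAOperatorsV1 (BondIdx)
open B6TranslateV1 (trV trV_apply)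
open B6TranslateTorusV1 (vch TB TB_apply TB_mul_TB_neg TB_neg_mul_TB TB_mul_mulOp mulOp_eq_conj toBox_add_tv)
open B6ScalarChartV1 (toBox_shift)
open B6Partition118KLevelFineSizes (C1F C1F_nonneg)
open B6Partition118KLevelTorusL0 (hT)
open B6Partition118KLevelTorusCentral (one_le_of_four_le)
open B6Partition118KLevelTorusCentralL0 (QT blkOf_mem_QT_of_hT_ne_zero)
open B6Partition118KLevelTorusBindersL0 (abs_hT_sub_le_near)
open B6Prop26KLevelSkeletonV1L0 (hB hB_apply ST mem_ST pref pref_nonneg abs_hB_le_one blkV1_mem_QT_of_hB_ne_zero)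
open B6InMajorantTransplant (InMajorant inMajorant_mono)
open B6CubeWindowV1 (one_le_of_eight_le four_le_of_five_le)
open B6CubeWindowV1L3 (x0C PlacedC)
open B6CubeWindowV1L3 (tC tC_j hx0 hfit hch_deep Gl)
open B6CubeWindowV1L0 (sc sc_inv wC hch j0 j0_le_level trV_hB)
open B6Eq292MemberTorusV1L3 (EC)
open B6CubeInDecayV1L3 (hGin_cube hEGin_cube)
open B6CubeCoeffSizesV1 (torusSupNorm_tshift_unitVec_le one_le_ell)
open B6CubeCoeffSizesV1L0 (blkOf_mem_QT_of_near_hT level_le_of_mem_QT)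
open B6Prop26LeftEntryKLevelV1 (hasMajorant_sandwich_in)
open B6Prop26KLevelAssemblyV1 (hasMajorant_smul)
open B10StarCount (shift_unshift unshift_shift)
open Literature.MathematicalPhysics.QuantumFieldTheory.Balaban1983to89.B6GradLegKLevelV1 (shB shB_apply DV DV_apply DV_mul_mulOp TB_mul_shB TB_mul_DV trV_shB abs_DV_apply transplant_Dl_apply_deep mulOp_mul_transplant_Dl)
open Literature.MathematicalPhysics.QuantumFieldTheory.Balaban1983to89.B6GradLegKLevelV1L0 (blkV1_mem_ST_of_hB_shift_ne_zero abs_hB_shift_sub_le pref_scale_le lip_scale_le)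

/-! ## §§1–2 of the original (the forward difference `shB`/`DV` algebra on a V1 torus and the member's transplanted `∇_ν` through the
full bond window) are `D`-free and are opened BY NAME above -/

/-! ## §3  The cube: `E_(ν,+)` against `DV`, the support and size of `S_νh_□` and `∇_νh_□`, the operator identity for `∇_ν(h_□G_□h_□)` -/

section Cube

variable {d ℓ : ℕ} {hd : 1 ≤ d + 1} {hL : Odd (ℓ + 1) ∧ 1 < ℓ + 1} {a₀ a₁ : ℝ} {m K : ℕ} {Mh k R : ℕ} {P' : Fin (d + 1) → ℕ}
variable (hN : ∀ μ, N0 ℓ Mh k P' μ = (PV d ℓ m K hd hL).sitesPerDir 0) {D : TDomains d ℓ Mh k P' R} (hk : k ≤ m + K)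
  (hMh1 : 1 ≤ Mh) (hP4 : ∀ μ, 4 ≤ P' μ) {a : ℕ} (hMha : Mh = (ℓ + 1) ^ a) (c : ↥(cubes D.toDomains)) (ha : a₀ ≤ a₁)

/-- `E_(ν,+)` of the cube is the conjugated transplant of the member's `∇_ν`. [cite: Balaban1984PropagatorsII, (2.92) p.239 (line 1), dictionary (charts)] -/
theorem EC_true (hpl : PlacedC ℓ k P' c.1) (w : BondIdx (B6GlobalChartV1L0.domT hN D hk) → ℝ) (cf : ℝ) (ν : Fin (d + 1)) :
    EC hN hk hMh1 hP4 hMha c ha hpl w cf (ν, true) = TB (-vch Mh k (svec ℓ k c.1.1 c.1.2)) *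
      transplant (cB (tC hN hk hMh1 hP4 c ha a (wC hN hk c w) cf) (x0C ℓ Mh k c.1) (hx0 hpl) (hfit hN hMh1 hP4 hMha c ha hpl)).W
        (eB (tC hN hk hMh1 hP4 c ha a (wC hN hk c w) cf) (x0C ℓ Mh k c.1)) (onFun ((tC hN hk hMh1 hP4 c ha a (wC hN hk c w) cf).Dl ν)) *
      TB (vch Mh k (svec ℓ k c.1.1 c.1.2)) := by
  unfold EC
  rw [if_pos rfl]

include hMha in
/-- **`χ·E_(ν,+) = (L^{j₀}/c′)•χ·DV ν c′`** for every multiplier `χ` whose chart translate `τ_vχ` is supported on `1`-deep bonds of the window (`c′ ≠ 0`).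
[cite: Balaban1984PropagatorsII, (2.92) p.239 (line 1), (2.94) p.239, (2.19) p.226, p.238 (T_□)] -/
theorem mulOp_mul_EC_true (hpl : PlacedC ℓ k P' c.1) (w : BondIdx (B6GlobalChartV1L0.domT hN D hk) → ℝ) {cf : ℝ} (hcf : cf ≠ 0) (ν : Fin (d + 1))
    (χ : PBond (PV d ℓ m K hd hL) 0 → ℝ)
    (hχ : ∀ b, trV (vch Mh k (svec ℓ k c.1.1 c.1.2)) χ b ≠ 0 →
      b.src ∈ DeepS (tC hN hk hMh1 hP4 c ha a (wC hN hk c w) cf) (x0C ℓ Mh k c.1) 1) :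
    mulOp χ * EC hN hk hMh1 hP4 hMha c ha hpl w cf (ν, true) =
      ((((ℓ + 1 : ℕ) : ℝ)) ^ j0 hMh1 hP4 c / cf) • (mulOp χ * DV ν cf) := by
  rw [EC_true, mulOp_eq_conj (vch Mh k (svec ℓ k c.1.1 c.1.2)) χ]
  set v := vch (ℓ := ℓ) (m := m) (K := K) (hd := hd) (hL := hL) Mh k (svec ℓ k c.1.1 c.1.2) with hv
  have e1 : TB (-v) * mulOp (trV v χ) * TB v *
      (TB (-v) * transplant (cB (tC hN hk hMh1 hP4 c ha a (wC hN hk c w) cf) (x0C ℓ Mh k c.1) (hx0 hpl) (hfit hN hMh1 hP4 hMha c ha hpl)).W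
        (eB (tC hN hk hMh1 hP4 c ha a (wC hN hk c w) cf) (x0C ℓ Mh k c.1)) (onFun ((tC hN hk hMh1 hP4 c ha a (wC hN hk c w) cf).Dl ν)) * TB v) =
      TB (-v) * (mulOp (trV v χ) * transplant (cB (tC hN hk hMh1 hP4 c ha a (wC hN hk c w) cf) (x0C ℓ Mh k c.1) (hx0 hpl)
        (hfit hN hMh1 hP4 hMha c ha hpl)).W (eB (tC hN hk hMh1 hP4 c ha a (wC hN hk c w) cf) (x0C ℓ Mh k c.1))
        (onFun ((tC hN hk hMh1 hP4 c ha a (wC hN hk c w) cf).Dl ν))) * TB v := by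
    simp only [mul_assoc]
    rw [← mul_assoc (TB v) (TB (-v)), TB_mul_TB_neg, one_mul]
  rw [e1, mulOp_mul_transplant_Dl _ _ _ _ ν hcf (trV v χ) hχ, tC_j, mul_smul_comm, smul_mul_assoc]
  congr 1
  simp only [mul_assoc]
  rw [← TB_mul_DV]

include hMha in
/-- the chart translate of `S_νh_□` is `S_νh^ch_□`, supported on `1`-deep bonds of the member's window (r03's `hch_deep`: margin `4L^{j₀+1} ≥ 2`).
[cite: Balaban1984PropagatorsII, p.238 (□ ⊂ □̃³), (2.36) p.229, bookkeeping] -/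
theorem shB_hB_deep (hM8 : 8 ≤ Mh) (hR2 : 2 * (ℓ + 1) ^ 2 ≤ R) (hpl : PlacedC ℓ k P' c.1) (w : BondIdx (B6GlobalChartV1L0.domT hN D hk) → ℝ) (cf : ℝ)
    (ν : Fin (d + 1)) (b : PBond (PV d ℓ m K hd hL) 0) (hb : trV (vch Mh k (svec ℓ k c.1.1 c.1.2)) (shB ν (hB hN D c)) b ≠ 0) :
    b.src ∈ DeepS (tC hN hk hMh1 hP4 c ha a (wC hN hk c w) cf) (x0C ℓ Mh k c.1) 1 := by
  rw [trV_shB, shB_apply, trV_hB hN hMh1 hP4 c] at hb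
  have hdeep := hch_deep hN hMh1 hP4 hMha c ha hM8 hR2 hb
  -- margin `4L^{j₀+1} ≥ 2` at the shifted point, hence margin `1` at `b₋`
  have h2 : (⟨b.src.shift ν, b.dir⟩ : PBond (PV d ℓ m K hd hL) 0).src ∈
      DeepS (tC hN hk hMh1 hP4 c ha a (wC hN hk c w) cf) (x0C ℓ Mh k c.1) (1 + 1) := by
    refine deepS_mono ?_ hdeep
    have : 1 ≤ (ℓ + 1) ^ (j0 hMh1 hP4 c + 1) := Nat.one_le_pow _ _ (Nat.succ_pos ℓ)
    omega
  have h3 := (unshift_mem_deepS (t := tC hN hk hMh1 hP4 c ha a (wC hN hk c w) cf) (hx0 hpl) h2 ν).1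
  simpa [unshift_shift] using h3

include hMha in
/-- **THE OPERATOR IDENTITY FOR THE FIRST LEG**: `∇_ν(h_□G_□h_□) = (c′/L^{j₀})•((S_νh_□)·(E_(ν,+)G_□)·h_□) + (∇_νh_□)·G_□·h_□` on the global torus.
[cite: Balaban1984PropagatorsII, (2.141) p.247 (first leg), (2.92) p.239 (line 1), (2.94) p.239] -/
theorem DV_sandwich_eq (hM8 : 8 ≤ Mh) (hR2 : 2 * (ℓ + 1) ^ 2 ≤ R) (hpl : PlacedC ℓ k P' c.1) (w : BondIdx (B6GlobalChartV1L0.domT hN D hk) → ℝ) {cf : ℝ}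
    (hcf : cf ≠ 0) (ν : Fin (d + 1)) :
    DV ν cf * (mulOp (hB hN D c) * Gl hN hk hMh1 hP4 hMha c ha hpl w cf * mulOp (hB hN D c)) =
      (cf / (((ℓ + 1 : ℕ) : ℝ)) ^ j0 hMh1 hP4 c) •
          (mulOp (shB ν (hB hN D c)) * (EC hN hk hMh1 hP4 hMha c ha hpl w cf (ν, true) * Gl hN hk hMh1 hP4 hMha c ha hpl w cf) *
            mulOp (hB hN D c)) +
        mulOp (DV ν cf (hB hN D c)) * Gl hN hk hMh1 hP4 hMha c ha hpl w cf * mulOp (hB hN D c) := by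
  have hLj : ((((ℓ + 1 : ℕ) : ℝ)) ^ j0 hMh1 hP4 c) ≠ 0 := by positivity
  have hh := shB_hB_deep hN hk hMh1 hP4 hMha c ha hM8 hR2 hpl w cf ν
  have key := mulOp_mul_EC_true hN hk hMh1 hP4 hMha c ha hpl w hcf ν (shB ν (hB hN D c)) ?key
  case key => intro b hb; exact hh b hb
  have hprod := DV_mul_mulOp ν cf (hB hN D c)
  clear hh
  -- atoms
  generalize EC hN hk hMh1 hP4 hMha c ha hpl w cf (ν, true) = E at key ⊢
  generalize Gl hN hk hMh1 hP4 hMha c ha hpl w cf = G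
  generalize mulOp (shB ν (hB hN D c)) = Sh at key hprod ⊢
  generalize mulOp (DV ν cf (hB hN D c)) = Dh at hprod ⊢
  generalize mulOp (hB hN D c) = Hm at hprod ⊢
  generalize (DV (P := PV d ℓ m K hd hL) ν cf) = Dv at key hprod ⊢
  -- `(S_νh_□)·DV = (c′/L^{j₀})•(S_νh_□)·E_(ν,+)`
  have key' : Sh * Dv = (cf / (((ℓ + 1 : ℕ) : ℝ)) ^ j0 hMh1 hP4 c) • (Sh * E) := by
    rw [key, smul_smul, div_mul_div_comm, mul_comm cf, div_self (mul_ne_zero hLj hcf), one_smul]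
  calc Dv * (Hm * G * Hm) = (Dv * Hm) * G * Hm := by simp only [mul_assoc]
    _ = (Sh * Dv + Dh) * G * Hm := by rw [hprod]
    _ = _ := by
        rw [add_mul, add_mul, key', smul_mul_assoc, smul_mul_assoc]
        simp only [mul_assoc]

end Cube

/-! ## §4  THE FIRST LEG OF (2.141) FOR `∇_νG`, PER CUBE: `∇_ν(h_□G_□h_□)` has the majorant `1_{□⁺}(y)·C_D·(L^{j(y)}/|c′|)·e^{−ρ_D d_T}` -/

section Leg

variable {d ℓ : ℕ} {hd : 1 ≤ d + 1} {hL : Odd (ℓ + 1) ∧ 1 < ℓ + 1} {m K : ℕ} {Mh k R : ℕ} {P' : Fin (d + 1) → ℕ}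

/-- pure-real core of `pref_scale_le`: `|c′|/J·(Λ/c′)² ≤ L²·(Λ·|c′|⁻¹)` once `Λ ≤ L²J`. [folklore] -/
private theorem scale_aux {L Λ J cf : ℝ} (hJ : 0 < J) (hΛ : 0 ≤ Λ) (hcf : cf ≠ 0) (h : Λ ≤ L ^ 2 * J) :
    |cf| / J * (Λ / cf) ^ 2 ≤ L ^ 2 * (Λ * |cf|⁻¹) := by
  have hc : 0 < |cf| := abs_pos.2 hcf
  have e : |cf| / J * (Λ / cf) ^ 2 = Λ / J * (Λ * |cf|⁻¹) := by
    rw [div_pow, show cf ^ 2 = |cf| ^ 2 from (sq_abs cf).symm]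
    field_simp
  rw [e]
  exact mul_le_mul_of_nonneg_right ((div_le_iff₀ hJ).2 h) (by positivity)

open Classical in
/-- **THE FIRST LEG OF (2.141) FOR THE ENTRY `|(∇GJ)(x)|`, PER CUBE, FOR THE GENUINE MEMBER** (`L ≥ 5`): there are `ρ_D > 0`, `C_D ≥ 0` (on `d, L`
and the weight band `[a₀, a₁]` only) such that on every admissible V1 torus (`M_h = Lᵃ ≥ 8`, `R ≥ 2L²`, `P′ ≥ 5`, cube placed), for every `c′ ≠ 0`,
weights `w`, direction `ν` and cube `□`:
`HasMajorant (geomT D) (blkV1 hN D) (∇_ν·(h_□G_□h_□)) (1_{□⁺}(y)·C_D·(L^{j(y)}·|c′|⁻¹)·e^{−ρ_D d_T(y,y′)})` — print's `O(1)·Lʲη·e^{−δd}` for the first leg,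
from (2.133)₁,₂ for the member (r03's `hGin_cube`/`hEGin_cube`) and the size of `∂h_□`.
[cite: Balaban1984PropagatorsII, Prop. 2.6 (2.136) p.247 («|(∇GJ)(x)| ≤ O(1)Lʲη…»), (2.141) p.247, (2.133) p.247, (2.92) p.239 line 1] -/
theorem hDG0_cube (d ℓ : ℕ) (hd : 1 ≤ d + 1) (hL : Odd (ℓ + 1) ∧ 1 < ℓ + 1) {a₀ a₁ : ℝ} (ha₀ : 0 < a₀) (ha₁ : a₀ ≤ a₁) :
    ∃ ρD : ℝ, 0 < ρD ∧ ∃ CD : ℝ, 0 ≤ CD ∧ ∀ (m K : ℕ) {Mh k R : ℕ} {P' : Fin (d + 1) → ℕ}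
      (hN : ∀ μ, N0 ℓ Mh k P' μ = (PV d ℓ m K hd hL).sitesPerDir 0) (D : B6MultiLevelTorusOperatorL0.TDomains d ℓ Mh k P' R) (hk : k ≤ m + K)
      (hMh1 : 1 ≤ Mh) (hP4 : ∀ μ, 4 ≤ P' μ) {a : ℕ} (hMha : Mh = (ℓ + 1) ^ a) (_ : 8 ≤ Mh) (_ : 2 * (ℓ + 1) ≤ Mh) (_ : 2 * (ℓ + 1) ^ 2 ≤ R)
      (_ : ∀ μ, 5 ≤ P' μ) (c : ↥(cubes D.toDomains)) (hpl : PlacedC ℓ k P' c.1) (w : BondIdx (domT hN D hk) → ℝ) {cf : ℝ} (_ : cf ≠ 0) (ν : Fin (d + 1)),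
      HasMajorant (g := geomT D) (blkV1 hN D)
        (DV ν cf * (mulOp (hB hN D c) * Gl hN hk hMh1 hP4 hMha c ha₁ hpl w cf * mulOp (hB hN D c)))
        (fun y y' => ind (ST D hMh1 hP4 c) y * (CD * ((geomT D).len y * |cf|⁻¹) * Real.exp (-(ρD * (geomT D).dist y y')))) := by
  obtain ⟨ρG, hρG, CG, hCG, hGin⟩ := hGin_cube d ℓ hd hL ha₀ ha₁
  obtain ⟨ρE, hρE, CE, hCE, hEGin⟩ := hEGin_cube d ℓ hd hL ha₀ ha₁
  refine ⟨min ρG ρE, lt_min hρG hρE, (((ℓ + 1 : ℕ) : ℝ)) ^ 2 * CE + (((ℓ + 1 : ℕ) : ℝ)) ^ 2 * C1F d ℓ * CG, by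
    have := C1F_nonneg d ℓ; positivity, ?_⟩
  intro m K Mh k R P' hN D hk hMh1 hP4 a hMha hM8 hMhL hR2 hP5 c hpl w cf hcf ν
  have hMh : 2 ≤ Mh := le_trans (by norm_num) hM8
  have hR : 2 * (ℓ + 1) ≤ R := le_trans (by nlinarith : 2 * (ℓ + 1) ≤ 2 * (ℓ + 1) ^ 2) hR2
  have hP : ∀ μ, 1 ≤ P' μ := one_le_of_four_le hP4
  have hdnn : ∀ y y' : (geomT D).Site, 0 ≤ (geomT D).dist y y' := fun _ _ => Nat.cast_nonneg _
  have hC1 := C1F_nonneg d ℓ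
  -- the two input-localised legs of the member
  have hE := hEGin m K hN D hk hMh1 hP4 hMha hMh hR2 c hpl w cf (ν, true)
  have hG := hGin m K hN D hk hMh1 hP4 hMha hMh hR2 c hpl w cf
  -- term 1: `(S_νh_□)·(E G_□)·h_□`
  have hT1 := hasMajorant_sandwich_in (g := geomT D) (blkV1 hN D) (S := ST D hMh1 hP4 c) (s := 1)
    (f := shB ν (hB hN D c)) (h := hB hN D c)
    (K := fun y y' => CE * pref cf y * Real.exp (-(ρE * (geomT D).dist y y')))
    (fun y y' => by have := pref_nonneg cf y; positivity) zero_le_one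
    (fun b hb => blkV1_mem_ST_of_hB_shift_ne_zero hN hMh1 hP4 c hM8 hR hP5 ν (by simpa [shB_apply] using hb))
    (fun b => by rw [shB_apply]; exact abs_hB_le_one hN D hMh1 hP c _)
    (fun b hb => (mem_ST D hMh1 hP4 c _).2 (blkV1_mem_QT_of_hB_ne_zero hN D hMh hR hP4 c hb))
    (fun b => abs_hB_le_one hN D hMh1 hP c b) hE
  -- term 2: `(∇_νh_□)·G_□·h_□`
  have hT2 := hasMajorant_sandwich_in (g := geomT D) (blkV1 hN D) (S := ST D hMh1 hP4 c)
    (s := |cf| * (C1F d ℓ / (8 / 5 * (bigSide ℓ Mh c.1.1 : ℝ))))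
    (f := DV ν cf (hB hN D c)) (h := hB hN D c)
    (K := fun y y' => CG * pref cf y * Real.exp (-(ρG * (geomT D).dist y y')))
    (fun y y' => by have := pref_nonneg cf y; positivity) (by positivity)
    (fun b hb => by
      by_cases h1 : hB hN D c ⟨b.src.shift ν, b.dir⟩ ≠ 0
      · exact blkV1_mem_ST_of_hB_shift_ne_zero hN hMh1 hP4 c hM8 hR hP5 ν h1
      · have h2 : hB hN D c b ≠ 0 := by
          intro h0; apply hb; rw [DV_apply, not_not.1 h1, h0]; ring
        exact (mem_ST D hMh1 hP4 c _).2 (blkV1_mem_QT_of_hB_ne_zero hN D hMh hR hP4 c h2))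
    (fun b => by rw [abs_DV_apply]; exact mul_le_mul_of_nonneg_left (abs_hB_shift_sub_le hN c hMhL hR hP5 ν b) (abs_nonneg _))
    (fun b hb => (mem_ST D hMh1 hP4 c _).2 (blkV1_mem_QT_of_hB_ne_zero hN D hMh hR hP4 c hb))
    (fun b => abs_hB_le_one hN D hMh1 hP c b) hG
  -- the operator identity and the sum of the two majorants
  rw [DV_sandwich_eq hN hk hMh1 hP4 hMha c ha₁ hM8 hR2 hpl w hcf ν]
  have hT1' := hasMajorant_smul (g := geomT D) (blkV1 hN D) hT1 (cf / (((ℓ + 1 : ℕ) : ℝ)) ^ j0 hMh1 hP4 c)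
  refine hasMajorant_mono _ (hasMajorant_add _ hT1' hT2) fun y y' => ?_
  -- pointwise comparison of the kernels
  have habs : |cf / (((ℓ + 1 : ℕ) : ℝ)) ^ j0 hMh1 hP4 c| = |cf| / (((ℓ + 1 : ℕ) : ℝ)) ^ j0 hMh1 hP4 c := by
    rw [abs_div, abs_of_pos (by positivity : (0 : ℝ) < (((ℓ + 1 : ℕ) : ℝ)) ^ j0 hMh1 hP4 c)]
  rw [habs]
  by_cases hy : y ∈ ST D hMh1 hP4 c
  · have hi : ind (ST D hMh1 hP4 c) y = 1 := ind_of_mem hy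
    rw [hi]
    have hlen : 0 ≤ (geomT D).len y * |cf|⁻¹ := by rw [geomT_len]; positivity
    have e1 : Real.exp (-(ρE * (geomT D).dist y y')) ≤ Real.exp (-(min ρG ρE * (geomT D).dist y y')) :=
      Real.exp_le_exp.mpr (neg_le_neg (mul_le_mul_of_nonneg_right (min_le_right _ _) (hdnn y y')))
    have e2 : Real.exp (-(ρG * (geomT D).dist y y')) ≤ Real.exp (-(min ρG ρE * (geomT D).dist y y')) :=
      Real.exp_le_exp.mpr (neg_le_neg (mul_le_mul_of_nonneg_right (min_le_left _ _) (hdnn y y')))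
    have hps := pref_scale_le hL hMh1 hP4 c hR2 hcf hy
    have hls := lip_scale_le hL hMh1 hP4 c hR2 hcf hy
    have hpref := pref_nonneg cf y
    calc |cf| / (((ℓ + 1 : ℕ) : ℝ)) ^ j0 hMh1 hP4 c * (1 * ind (ST D hMh1 hP4 c) y' * (1 * (CE * pref cf y * Real.exp (-(ρE * (geomT D).dist y y'))))) +
          1 * ind (ST D hMh1 hP4 c) y' * (|cf| * (C1F d ℓ / (8 / 5 * (bigSide ℓ Mh c.1.1 : ℝ))) *
            (CG * pref cf y * Real.exp (-(ρG * (geomT D).dist y y'))))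
        ≤ |cf| / (((ℓ + 1 : ℕ) : ℝ)) ^ j0 hMh1 hP4 c * (1 * 1 * (1 * (CE * pref cf y * Real.exp (-(min ρG ρE * (geomT D).dist y y'))))) +
          1 * 1 * (|cf| * (C1F d ℓ / (8 / 5 * (bigSide ℓ Mh c.1.1 : ℝ))) *
            (CG * pref cf y * Real.exp (-(min ρG ρE * (geomT D).dist y y')))) := by
          gcongr
          · exact ind_le_one _ _
          · exact ind_le_one _ _
      _ = CE * (|cf| / (((ℓ + 1 : ℕ) : ℝ)) ^ j0 hMh1 hP4 c * pref cf y) * Real.exp (-(min ρG ρE * (geomT D).dist y y')) +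
          CG * (|cf| * (C1F d ℓ / (8 / 5 * (bigSide ℓ Mh c.1.1 : ℝ))) * pref cf y) * Real.exp (-(min ρG ρE * (geomT D).dist y y')) := by ring
      _ ≤ CE * ((((ℓ + 1 : ℕ) : ℝ)) ^ 2 * ((geomT D).len y * |cf|⁻¹)) * Real.exp (-(min ρG ρE * (geomT D).dist y y')) +
          CG * ((((ℓ + 1 : ℕ) : ℝ)) ^ 2 * C1F d ℓ * ((geomT D).len y * |cf|⁻¹)) * Real.exp (-(min ρG ρE * (geomT D).dist y y')) := by
          gcongr
      _ = 1 * (((((ℓ + 1 : ℕ) : ℝ)) ^ 2 * CE + (((ℓ + 1 : ℕ) : ℝ)) ^ 2 * C1F d ℓ * CG) * ((geomT D).len y * |cf|⁻¹) *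
          Real.exp (-(min ρG ρE * (geomT D).dist y y'))) := by ring
  · have hi : ind (ST D hMh1 hP4 c) y = 0 := ind_of_not_mem hy
    rw [hi]
    simp

end Leg

end Literature.MathematicalPhysics.QuantumFieldTheory.Balaban1983to89.B6GradLegKLevelV1L3
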